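import Literature.Analysis.OperatorTheory.YangMillsMatrixModelGroundStateSymmetry
import HarnessLib

/-!
# Spatial REFLECTIONS of Lüscher's matrix-model Hamiltonian: `x_k ↦ −x_k` preserves `V`, commutes with colour rotations, fixes the positive ground state

Topic `Literature/Analysis/OperatorTheory`; sequel of `YangMillsMatrixModelGroundStateSymmetry.lean` (row permutations and the parity `x ↦ −x`).  The remaining
generators of the hyperoctahedral symmetry of the three spatial links are the single-row sign flips `R_k : x_k ↦ −x_k` (`x_i ↦ x_i`, `i ≠ k`), realised as the
Mathlib isometry `piLpCongrRight (p ↦ if p.1 = k then neg else refl)`: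

* `rowNeg_apply` (coordinates), `colourVec_rowNeg` (`= ±colourVec`), `luscherPotential_rowNeg` (`|(±x_i) × (±x_j)|² = |x_i × x_j|²`), `colourRotate_rowNeg`;
* ★ `groundState_rowNeg` — the positive normalised invariant ground state satisfies `ψ(R_k y) = ψ(y)` (`groundState_comp_eq_self`).

Theorems only; no named facts.  References: M. Lüscher, NPB 219 (1983) 233, §2 [cite: Luscher1983, §2]; Reed–Simon IV [cite: ReedSimonIV1978, Thm. XIII.47–48].
-/

noncomputable section

open MeasureTheory Filter Topology
open scoped BigOperators Matrix

namespace Literature.Analysis.OperatorTheory.YMMatrixModel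

/-- Coordinates of the row sign flip `R_k`: `(R_k y)_{(i,a)} = −y_{(i,a)}` if `i = k`, else `y_{(i,a)}`. [cite: Luscher1983, §2] -/
theorem rowNeg_apply (k : Fin 3) (y : ZM) (p : Fin 3 × Fin 3) :
    LinearIsometryEquiv.piLpCongrRight 2 (fun q : Fin 3 × Fin 3 => if q.1 = k then LinearIsometryEquiv.neg ℝ (E := ℝ) else LinearIsometryEquiv.refl ℝ ℝ) y p =
      if p.1 = k then -y p else y p := by
  rw [LinearIsometryEquiv.piLpCongrRight_apply]
  show (if p.1 = k then LinearIsometryEquiv.neg ℝ (E := ℝ) else LinearIsometryEquiv.refl ℝ ℝ) (y p) = _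
  split_ifs with h
  · rfl
  · rfl

/-- `colourVec (R_k y) i = ε_i • colourVec y i`, `ε_k = −1`, `ε_i = 1` otherwise. [cite: Luscher1983, §2] -/
theorem colourVec_rowNeg (k : Fin 3) (y : ZM) (i : Fin 3) :
    colourVec (LinearIsometryEquiv.piLpCongrRight 2
        (fun q : Fin 3 × Fin 3 => if q.1 = k then LinearIsometryEquiv.neg ℝ (E := ℝ) else LinearIsometryEquiv.refl ℝ ℝ) y) i =
      (if i = k then (-1 : ℝ) else 1) • colourVec y i := by
  funext a
  have h1 := rowNeg_apply k y (i, a)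
  simp only [colourVec, Pi.smul_apply, smul_eq_mul]
  rw [show (LinearIsometryEquiv.piLpCongrRight 2
      (fun q : Fin 3 × Fin 3 => if q.1 = k then LinearIsometryEquiv.neg ℝ (E := ℝ) else LinearIsometryEquiv.refl ℝ ℝ) y) (i, a) =
      if i = k then -y (i, a) else y (i, a) from h1]
  split_ifs <;> ring

/-- The potential is invariant under row sign flips (`|(ε_i x_i) × (ε_j x_j)|² = |x_i × x_j|²`, `ε² = 1`). [cite: Luscher1983, §2] -/
theorem luscherPotential_rowNeg (k : Fin 3) (y : ZM) :
    luscherPotential (LinearIsometryEquiv.piLpCongrRight 2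
        (fun q : Fin 3 × Fin 3 => if q.1 = k then LinearIsometryEquiv.neg ℝ (E := ℝ) else LinearIsometryEquiv.refl ℝ ℝ) y) = luscherPotential y := by
  unfold luscherPotential
  simp only [colourVec_rowNeg]
  congr 1
  refine Finset.sum_congr rfl fun i _ => Finset.sum_congr rfl fun j _ => ?_
  have hi : (if i = k then (-1 : ℝ) else 1) * (if i = k then (-1 : ℝ) else 1) = 1 := by split_ifs <;> norm_num
  have hj : (if j = k then (-1 : ℝ) else 1) * (if j = k then (-1 : ℝ) else 1) = 1 := by split_ifs <;> norm_num
  rw [LinearMap.map_smul₂, LinearMap.map_smul, smul_dotProduct, dotProduct_smul, dotProduct_smul, smul_dotProduct, smul_eq_mul, smul_eq_mul,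
    smul_eq_mul, smul_eq_mul]
  set D := (colourVec y i ⨯₃ colourVec y j) ⬝ᵥ (colourVec y i ⨯₃ colourVec y j)
  calc (if i = k then (-1 : ℝ) else 1) * ((if i = k then (-1 : ℝ) else 1) * ((if j = k then (-1 : ℝ) else 1) * ((if j = k then (-1 : ℝ) else 1) * D)))
      = ((if i = k then (-1 : ℝ) else 1) * (if i = k then (-1 : ℝ) else 1)) * ((if j = k then (-1 : ℝ) else 1) * (if j = k then (-1 : ℝ) else 1)) * D := by ring
    _ = D := by rw [hi, hj, one_mul, one_mul]

/-- Row sign flips commute with colour rotations. [cite: Luscher1983, §2] -/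
theorem colourRotate_rowNeg (M : Matrix (Fin 3) (Fin 3) ℝ) (k : Fin 3) (y : ZM) :
    LinearIsometryEquiv.piLpCongrRight 2
        (fun q : Fin 3 × Fin 3 => if q.1 = k then LinearIsometryEquiv.neg ℝ (E := ℝ) else LinearIsometryEquiv.refl ℝ ℝ) (colourRotate M y) =
      colourRotate M (LinearIsometryEquiv.piLpCongrRight 2
        (fun q : Fin 3 × Fin 3 => if q.1 = k then LinearIsometryEquiv.neg ℝ (E := ℝ) else LinearIsometryEquiv.refl ℝ ℝ) y) := by
  ext p
  rw [rowNeg_apply, colourRotate_apply, colourRotate_apply]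
  by_cases h : p.1 = k
  · rw [if_pos h, ← Finset.sum_neg_distrib]
    exact Finset.sum_congr rfl fun b _ => by rw [rowNeg_apply, if_pos h]; ring
  · rw [if_neg h]
    exact Finset.sum_congr rfl fun b _ => by rw [rowNeg_apply, if_neg h]

/-- ★ **The positive ground state is invariant under every row sign flip**: `ψ(R_k y) = ψ(y)`. [cite: Luscher1983, §2] [cite: ReedSimonIV1978, Thm. XIII.47–48] -/
theorem groundState_rowNeg (k : Fin 3) {ψ : ZM → ℝ} (hψ : ContDiff ℝ 2 ψ) (hinv : IsGaugeInv ψ)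
    (heig : ∀ x, hApply ψ x = physLevel 1 * ψ x) (hdec : ∃ C : ℝ, ∀ x, |ψ x| ≤ C * Real.exp (-‖x‖))
    (hnorm : ∫ x, ψ x * ψ x = (1 : ℝ)) (hpos : ∀ x, 0 < ψ x) (y : ZM) :
    ψ (LinearIsometryEquiv.piLpCongrRight 2
        (fun q : Fin 3 × Fin 3 => if q.1 = k then LinearIsometryEquiv.neg ℝ (E := ℝ) else LinearIsometryEquiv.refl ℝ ℝ) y) = ψ y :=
  congrFun (groundState_comp_eq_self _ (luscherPotential_rowNeg k) (fun M _ y => colourRotate_rowNeg M k y) hψ hinv heig hdec hnorm hpos) y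

end Literature.Analysis.OperatorTheory.YMMatrixModel

end
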